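import Mathlib
import Summits.QuantumFields.BalabanUV.T4Continuum.Support.NE3CombVsTowerStraighten
import Summits.QuantumFields.BalabanUV.T4Continuum.Support.NE3CombVsTowerLineSums
import HarnessLib

/-!
# NE3 support, route (H♮) row K4-0 file 4 (END): the single-scale comb line sum versus the nested straight tower

OWNER's row K4-0 (journal SHAPE K4 l.17848) in the corrected, conjugated form of the located convention point C-ne3leaf04g5-2
(l.18557; this lineage's SHAPE l.18587): for `M = L^{k+1}` and the small-field tower class of `W` (`IsUnitaryCfg W`, `0 ≤ x`,
`LevelSmall d L k x`, `SmallField W x`, `L ≥ 2`),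

  `‖(M^d)⁻¹ • TWc L (k+1) W η z κ − Ad (cavgIter L (k+1) W z κ) (QstrIter L (k+1) W η z κ)‖`
  `   ≤ 2·((4d+5)∕10)·DSum d L (k+1) x · (M^d)⁻¹ Σ_{v∈[0,M)^d} Σ_{i<M} ‖η (M•z + v + i•e_κ) κ‖`      (`norm_TWc_sub_Ad_QstrIter_le`)
  `   ≤ (16d+20)·loopRad(d, L, (prop1Radius d L)^[k] x) · (M^d)⁻¹ Σ_{v,i} ‖η …‖`                      (`norm_TWc_sub_Ad_QstrIter_le_top`)

— k-FREE (top-dominated geometric series, this lineage's `DSum_le_top`), where `TWc` is leaf-03's κ-last comb line sum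
(`NE3CovariantLineAdjointFrame`, every copy transported to the corner `M•z` along `treeWord (v − v_κe_κ) ++ seg κ (v_κ + i + 1)`) and
`QstrIter` is this lineage's nested straight covariant tower (`NE3CovariantLineSumsTower`); plus the ℓ²(torus) twin
`sum_norm_TWc_sub_Ad_QstrIter_sq_le`.  Both objects are `O(M·mean)` (a line of `M` block means); the bound is relative to that size.

Proof: induction over `QstrIter_succ` (finest level first).  §1 re-indexing `[0,L^{k+1})^d × [0,L^{k+1})` = coarse copies × fine
offsets (`sum_block_line_reindex`, the tree's `sum_periodBox_blocks`∕`sum_range_mul`); §2 the EXACT step identity: reading the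
coarse field `Qstr L W η` through `TWc L k (cavg L W)`, the coarse copy's own averaged bond cancels the end frame (file 1 +
`combTransport_succ`), so the step difference is a sum over fine copies of `Ad_{comb_{k+1}(W)} − Ad_{comb_k(V̄)·fine tree·segment}`
(`TWc_cavg_Qstr_eq`, `step_sub_eq`); §3 its norm via file 3's `norm_comb_step_sub_le` (`≤ 2(4d+5)L^k·loopRad·mean`) and the
induction with `‖Qstr‖ ≤ block-line mean` (`sum_norm_Qstr_le`), the numeric recursion being exactly `((4d+5)∕10)·DSum`.

HONEST: kinematics∕elementary estimates on OUR frame; (P♮)_W, (ML_w) at W ≠ 1, T-E_w, NE3 are NOT proved here; spine 0∕9; finite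
T⁴ rung (B)+1 — NOT infinite volume ∕ mass gap ∕ BetaPertH ∕ Clay.  PLACEMENT: `Summits/QuantumFields/BalabanUV/` (cell rule).
-/

set_option autoImplicit false

open scoped BigOperators Matrix.Norms.L2Operator
open Finset

namespace Summit.QuantumFields.BalabanUV.T4Continuum.NE3CombVsTowerEnd

open Literature.MathematicalPhysics.QuantumFieldTheory.Balaban1983to89
open B7Prop1Explicit B7Prop2Explicit
open T4AveragingDeficitWall (IsUnitaryCfg SmallField Ad)
open T4AveragingDeficitNonAbelian (Ad_mul Ad_sub)
open T4AveragingDeficitWallBoundary (periodBox mem_periodBox sum_periodBox_shift)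
open AveragingDeficitTransport (norm_Ad_of_unitary mem_U1_of_unitary)
open AveragingDeficitNearIdentity (Ad_sum Ad_real_smul)
open AveragingDeficitChartCalculus (cavg)
open AveragingDeficitBlockDensity (cavg_mem)
open AveragingDeficitTwoLevelPrep (prop1Radius)
open AveragingDeficitMultiLevelPrep (cavgIter LevelSmall)
open NE3TangentCovariantTower (step_small)
open SpreadLift (loopRad)
open NE3BlockLineAverage (sum_univ_boxVec sum_periodBox_blocks sum_range_mul)
open NE3CovariantLineSums (Qstr)
open NE3CovariantLineSumsTower (QstrIter)
open NE3CovariantLineAdjoint (klastWord combTransport combTransport_succ TWc TWc_eq)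
open NE3ExactLineSums (norm_Ad_sub_Ad_le)
open NE3ExactLineSumsTower (DSum DSum_succ DSum_nonneg DSum_le_top)
open NE3CombVsTowerLineSums (Qstr_eq_Ad_copySum)
open NE3CombVsTowerPaths (norm_hol_le_one)
open NE3CombVsTowerStraighten (norm_comb_step_sub_le)

noncomputable section

variable {d : ℕ} {n : Type*} [Fintype n] [DecidableEq n]

/-! ## §1 Re-indexing: coarse copies × fine offsets -/

/-- **`[0,L^{k+1})^d × [0,L^{k+1})` = COARSE COPIES × FINE OFFSETS**: `v = L•v₁ + r`, `i = L·i₁ + i′`. [folklore] -/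
theorem sum_block_line_reindex {β : Type*} [AddCommMonoid β] {L : ℕ} (hL : 1 ≤ L) (k : ℕ) (F : Site d → ℕ → β) :
    ∑ v ∈ periodBox (d := d) (L ^ (k + 1)), ∑ i ∈ range (L ^ (k + 1)), F v i
      = ∑ v₁ ∈ periodBox (d := d) (L ^ k), ∑ i₁ ∈ range (L ^ k), ∑ r : Fin d → Fin L, ∑ i' ∈ range L,
          F ((L : ℤ) • v₁ + boxVec L r) (L * i₁ + i') := by
  rw [show periodBox (d := d) (L ^ (k + 1)) = periodBox (L * L ^ k) by rw [pow_succ'], ← sum_periodBox_blocks L (L ^ k) hL]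
  refine Finset.sum_congr rfl fun v₁ _ => ?_
  rw [← sum_univ_boxVec, show range (L ^ (k + 1)) = range (L ^ k * L) by rw [pow_succ]]
  simp only [sum_range_mul]
  rw [Finset.sum_comm]

/-- The fine site of the copy `(v₁, i₁; r, i′)`: `L^{k+1}•z + (L•v₁ + r) + (L·i₁ + i′)•e_κ = L•(L^k•z + v₁ + i₁•e_κ) + r + i′•e_κ`. [folklore] -/
theorem fine_site_eq (L k : ℕ) (z v₁ : Site d) (r : Fin d → Fin L) (i₁ i' : ℕ) (κ : Fin d) :
    (((L ^ (k + 1) : ℕ) : ℤ)) • z + ((L : ℤ) • v₁ + boxVec L r) + ((L * i₁ + i' : ℕ) : ℤ) • e κ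
      = (L : ℤ) • ((((L ^ k : ℕ) : ℤ)) • z + v₁ + (i₁ : ℤ) • e κ) + boxVec L r + (i' : ℤ) • e κ := by
  ext ι; simp only [Pi.add_apply, Pi.smul_apply, smul_eq_mul]; push_cast; ring

/-- The corner: `L^{k+1}•z = L•(L^k•z)`. [folklore] -/
theorem corner_eq (L k : ℕ) (z : Site d) : (((L ^ (k + 1) : ℕ) : ℤ)) • z = (L : ℤ) • ((((L ^ k : ℕ) : ℤ)) • z) := by
  rw [smul_smul]; push_cast; rw [pow_succ']

/-- **`TWc` AT THE NEXT SCALE, RE-INDEXED**: every fine copy `(v₁, i₁; r, i′)` is transported to the corner `L^{k+1}•z` along the fine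
κ-last comb word `klastWord κ (L•v₁ + r) (L·i₁ + i′ + 1)`. [folklore] -/
theorem TWc_succ_eq {L : ℕ} (hL : 1 ≤ L) (k : ℕ) (W : Site d → Fin d → (Matrix n n ℂ)ˣ) (η : Site d → Fin d → Matrix n n ℂ)
    (z : Site d) (κ : Fin d) :
    TWc L (k + 1) W η z κ = ∑ v₁ ∈ periodBox (d := d) (L ^ k), ∑ i₁ ∈ range (L ^ k), ∑ r : Fin d → Fin L, ∑ i' ∈ range L,
      Ad (hol W ((L : ℤ) • ((((L ^ k : ℕ) : ℤ)) • z)) (klastWord κ ((L : ℤ) • v₁ + boxVec L r) (L * i₁ + i' + 1)))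
        (η ((L : ℤ) • ((((L ^ k : ℕ) : ℤ)) • z + v₁ + (i₁ : ℤ) • e κ) + boxVec L r + (i' : ℤ) • e κ) κ) := by
  rw [TWc_eq, sum_block_line_reindex hL k]
  refine Finset.sum_congr rfl fun v₁ _ => Finset.sum_congr rfl fun i₁ _ => Fintype.sum_congr _ _ fun r =>
    Finset.sum_congr rfl fun i' _ => ?_
  rw [combTransport, fine_site_eq, corner_eq]

/-! ## §2 The exact step identity -/

/-- **READING THE COARSE FIELD `Qstr L W η` THROUGH `TWc L k (cavg L W)`**: the coarse copy's own averaged bond (the «including the own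
bond» factor of the comb transport, `combTransport_succ`) CANCELS the end frame `Ad V̄⁻¹` of `Qstr` (file 1), so every fine copy is read
through «coarse κ-last comb of `V̄ = cavg L W` up to the START of its coarse copy · fine tree·segment including its own bond», weight
`L^{−d}` — EXACT at every `W`. [folklore] -/
theorem TWc_cavg_Qstr_eq (L k : ℕ) (W : Site d → Fin d → (Matrix n n ℂ)ˣ) (η : Site d → Fin d → Matrix n n ℂ) (z : Site d) (κ : Fin d) :
    TWc L k (cavg L W) (Qstr L W η) z κ = ∑ v₁ ∈ periodBox (d := d) (L ^ k), ∑ i₁ ∈ range (L ^ k), ∑ r : Fin d → Fin L, ∑ i' ∈ range L,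
      (((L : ℝ) ^ d)⁻¹) • Ad (hol (cavg L W) ((((L ^ k : ℕ) : ℤ)) • z) (klastWord κ v₁ i₁)
          * hol W ((L : ℤ) • ((((L ^ k : ℕ) : ℤ)) • z + v₁ + (i₁ : ℤ) • e κ)) (treeWord (boxVec L r) ++ seg κ ((i' + 1 : ℕ) : ℤ)))
        (η ((L : ℤ) • ((((L ^ k : ℕ) : ℤ)) • z + v₁ + (i₁ : ℤ) • e κ) + boxVec L r + (i' : ℤ) • e κ) κ) := by
  rw [TWc_eq]
  refine Finset.sum_congr rfl fun v₁ _ => Finset.sum_congr rfl fun i₁ _ => ?_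
  rw [combTransport_succ, Qstr_eq_Ad_copySum, ← Ad_mul, mul_inv_cancel_right, combTransport, Ad_sum]
  refine Finset.sum_congr rfl fun r _ => ?_
  rw [Ad_sum]
  refine Finset.sum_congr rfl fun i' _ => ?_
  rw [Ad_real_smul, ← Ad_mul, hol_append, disp_treeWord]

/-- **THE EXACT STEP IDENTITY**: with `ρ = L^{−d}`,
`(ρ^{k+1}•TWc L (k+1) W η − Ad (cavgIter (k+1) W) (QstrIter (k+1) W η)) − (ρ^k•TWc L k V̄ (Qstr W η) − Ad (cavgIter k V̄) (QstrIter k V̄ (Qstr W η)))`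
`= Σ_{fine copies} ρ^{k+1}•(Ad_{fine comb of W} − Ad_{coarse comb of V̄ · fine tree·segment}) (η(copy) κ)` (`V̄ = cavg L W`; the
tower terms agree by `QstrIter_succ`∕`cavgIter`, definitionally). [folklore] -/
theorem step_sub_eq {L : ℕ} (hL : 1 ≤ L) (k : ℕ) (W : Site d → Fin d → (Matrix n n ℂ)ˣ) (η : Site d → Fin d → Matrix n n ℂ)
    (z : Site d) (κ : Fin d) :
    ((((L : ℝ) ^ d)⁻¹) ^ (k + 1) • TWc L (k + 1) W η z κ - Ad (cavgIter L (k + 1) W z κ) (QstrIter L (k + 1) W η z κ))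
        - ((((L : ℝ) ^ d)⁻¹) ^ k • TWc L k (cavg L W) (Qstr L W η) z κ
            - Ad (cavgIter L k (cavg L W) z κ) (QstrIter L k (cavg L W) (Qstr L W η) z κ))
      = ∑ v₁ ∈ periodBox (d := d) (L ^ k), ∑ i₁ ∈ range (L ^ k), ∑ r : Fin d → Fin L, ∑ i' ∈ range L,
          (((L : ℝ) ^ d)⁻¹) ^ (k + 1) •
            (Ad (hol W ((L : ℤ) • ((((L ^ k : ℕ) : ℤ)) • z)) (klastWord κ ((L : ℤ) • v₁ + boxVec L r) (L * i₁ + i' + 1)))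
                (η ((L : ℤ) • ((((L ^ k : ℕ) : ℤ)) • z + v₁ + (i₁ : ℤ) • e κ) + boxVec L r + (i' : ℤ) • e κ) κ)
              - Ad (hol (cavg L W) ((((L ^ k : ℕ) : ℤ)) • z) (klastWord κ v₁ i₁)
                  * hol W ((L : ℤ) • ((((L ^ k : ℕ) : ℤ)) • z + v₁ + (i₁ : ℤ) • e κ)) (treeWord (boxVec L r) ++ seg κ ((i' + 1 : ℕ) : ℤ)))
                (η ((L : ℤ) • ((((L ^ k : ℕ) : ℤ)) • z + v₁ + (i₁ : ℤ) • e κ) + boxVec L r + (i' : ℤ) • e κ) κ)) := by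
  have hQ : Ad (cavgIter L (k + 1) W z κ) (QstrIter L (k + 1) W η z κ)
      = Ad (cavgIter L k (cavg L W) z κ) (QstrIter L k (cavg L W) (Qstr L W η) z κ) := rfl
  rw [hQ, sub_sub_sub_cancel_right, TWc_succ_eq hL, TWc_cavg_Qstr_eq]
  simp only [Finset.smul_sum, smul_smul, smul_sub, ← Finset.sum_sub_distrib, pow_succ]

/-! ## §3 The bounds -/

section Small

variable [Nonempty n] {L : ℕ} (hL2 : 2 ≤ L) {W : Site d → Fin d → (Matrix n n ℂ)ˣ} (hWu : IsUnitaryCfg W) {x : ℝ} (hx : 0 ≤ x)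
  (h512 : 512 * (d + 1) * (d + 4) * (L : ℝ) ^ 2 * x ≤ 1) (hWx : SmallField W x)

include hL2 hWu hx h512 hWx

omit hL2 in
/-- **`‖Qstr‖ ≤ THE BLOCK-LINE MEAN OF `‖η‖`**, summed over the coarse copies of a coarse block line: (unitarity of the transports and of
`V̄` in the small-field class). [folklore] -/
theorem sum_norm_Qstr_le (hL : 1 ≤ L) (k : ℕ) (η : Site d → Fin d → Matrix n n ℂ) (z : Site d) (κ : Fin d) :
    ∑ v₁ ∈ periodBox (d := d) (L ^ k), ∑ i₁ ∈ range (L ^ k), ‖Qstr L W η ((((L ^ k : ℕ) : ℤ)) • z + v₁ + (i₁ : ℤ) • e κ) κ‖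
      ≤ (((L : ℝ) ^ d)⁻¹) * ∑ v₁ ∈ periodBox (d := d) (L ^ k), ∑ i₁ ∈ range (L ^ k), ∑ r : Fin d → Fin L, ∑ i' ∈ range L,
          ‖η ((L : ℤ) • ((((L ^ k : ℕ) : ℤ)) • z + v₁ + (i₁ : ℤ) • e κ) + boxVec L r + (i' : ℤ) • e κ) κ‖ := by
  have hWu' : ∀ (y : Site d) (μ : Fin d), W y μ ∈ unitaryUnits (Matrix n n ℂ) := fun y μ => hWu y μ
  have hρ : 0 ≤ ((L : ℝ) ^ d)⁻¹ := by positivity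
  rw [Finset.mul_sum]
  refine Finset.sum_le_sum fun v₁ _ => ?_
  rw [Finset.mul_sum]
  refine Finset.sum_le_sum fun i₁ _ => ?_
  rw [Qstr_eq_Ad_copySum, norm_Ad_of_unitary ((unitaryUnits _).inv_mem (cavg_mem hL hWu hx h512 hWx _ _)), Finset.mul_sum]
  refine (norm_sum_le _ _).trans (Finset.sum_le_sum fun r _ => ?_)
  rw [Finset.mul_sum]
  refine (norm_sum_le _ _).trans (Finset.sum_le_sum fun i' _ => ?_)
  rw [norm_smul, Real.norm_of_nonneg hρ,
    norm_Ad_of_unitary ((unitaryUnits _).mul_mem (hol_mem_of hWu' _ _) (hol_mem_of hWu' _ _))]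

omit [Nonempty n] hL2 hWu hx h512 hWx in
/-- The mean of `‖η‖` over the fine copies, re-indexed. [folklore] -/
theorem sum_norm_reindex (hL : 1 ≤ L) (k : ℕ) (η : Site d → Fin d → Matrix n n ℂ) (z : Site d) (κ : Fin d) :
    ∑ v ∈ periodBox (d := d) (L ^ (k + 1)), ∑ i ∈ range (L ^ (k + 1)), ‖η ((((L ^ (k + 1) : ℕ) : ℤ)) • z + v + (i : ℤ) • e κ) κ‖
      = ∑ v₁ ∈ periodBox (d := d) (L ^ k), ∑ i₁ ∈ range (L ^ k), ∑ r : Fin d → Fin L, ∑ i' ∈ range L,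
          ‖η ((L : ℤ) • ((((L ^ k : ℕ) : ℤ)) • z + v₁ + (i₁ : ℤ) • e κ) + boxVec L r + (i' : ℤ) • e κ) κ‖ := by
  rw [sum_block_line_reindex hL k]
  simp only [fine_site_eq]

/-- **THE NORM OF THE STEP**: `≤ 2·(4d+5)·L^k·loopRad d L x · ρ^{k+1}·Σ_{fine copies} ‖η‖` (file 3's one-step path mismatch, copy by
copy, with `‖Ad_A − Ad_B‖ ≤ 2‖A − B‖`). [folklore] -/
theorem norm_step_sub_le (k : ℕ) (η : Site d → Fin d → Matrix n n ℂ) (z : Site d) (κ : Fin d) :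
    ‖((((L : ℝ) ^ d)⁻¹) ^ (k + 1) • TWc L (k + 1) W η z κ - Ad (cavgIter L (k + 1) W z κ) (QstrIter L (k + 1) W η z κ))
        - ((((L : ℝ) ^ d)⁻¹) ^ k • TWc L k (cavg L W) (Qstr L W η) z κ
            - Ad (cavgIter L k (cavg L W) z κ) (QstrIter L k (cavg L W) (Qstr L W η) z κ))‖
      ≤ 2 * ((4 * d + 5) * (L : ℝ) ^ k * loopRad d L x) * ((((L : ℝ) ^ d)⁻¹) ^ (k + 1)
          * ∑ v ∈ periodBox (d := d) (L ^ (k + 1)), ∑ i ∈ range (L ^ (k + 1)), ‖η ((((L ^ (k + 1) : ℕ) : ℤ)) • z + v + (i : ℤ) • e κ) κ‖) := by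
  have hL : 1 ≤ L := le_trans (by norm_num) hL2
  have hWu' : ∀ (y : Site d) (μ : Fin d), W y μ ∈ unitaryUnits (Matrix n n ℂ) := fun y μ => hWu y μ
  have hcu' : ∀ (y : Site d) (μ : Fin d), cavg L W y μ ∈ unitaryUnits (Matrix n n ℂ) := fun y μ => cavg_mem hL hWu hx h512 hWx y μ
  have hρ : 0 ≤ (((L : ℝ) ^ d)⁻¹) ^ (k + 1) := by positivity
  have hM : 1 ≤ L ^ k := Nat.one_le_pow _ _ hL
  have hS : 0 ≤ (4 * d + 5) * (L : ℝ) ^ k * loopRad d L x := by unfold loopRad; positivity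
  rw [step_sub_eq hL, sum_norm_reindex hL, Finset.mul_sum, Finset.mul_sum]
  refine (norm_sum_le _ _).trans (Finset.sum_le_sum fun v₁ hv₁ => ?_)
  rw [Finset.mul_sum, Finset.mul_sum]
  refine (norm_sum_le _ _).trans (Finset.sum_le_sum fun i₁ hi₁ => ?_)
  rw [Finset.mul_sum, Finset.mul_sum]
  refine (norm_sum_le _ _).trans (Finset.sum_le_sum fun r _ => ?_)
  rw [Finset.mul_sum, Finset.mul_sum]
  refine (norm_sum_le _ _).trans (Finset.sum_le_sum fun i' _ => ?_)
  rw [norm_smul, Real.norm_of_nonneg hρ]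
  have hstep := norm_comb_step_sub_le hWu hx h512 hWx hL2 hM ((((L ^ k : ℕ) : ℤ)) • z) κ hv₁ (Finset.mem_range.mp hi₁) r i'
  -- `‖Ad_a X − Ad_b X‖ ≤ 2‖b⁻¹a − 1‖‖X‖ ≤ 2‖a − b‖‖X‖` (the tree's `norm_Ad_sub_Ad_le`, `b` unitary)
  have hAd : ∀ {a b : (Matrix n n ℂ)ˣ}, a ∈ unitaryUnits (Matrix n n ℂ) → b ∈ unitaryUnits (Matrix n n ℂ) → ∀ X : Matrix n n ℂ,
      ‖Ad a X - Ad b X‖ ≤ 2 * ‖(a : Matrix n n ℂ) - (b : Matrix n n ℂ)‖ * ‖X‖ := by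
    intro a b ha hb X
    refine (norm_Ad_sub_Ad_le ha hb X).trans ?_
    have h : (((b⁻¹ * a : (Matrix n n ℂ)ˣ)) : Matrix n n ℂ) - 1 = ((b⁻¹ : (Matrix n n ℂ)ˣ) : Matrix n n ℂ) * ((a : Matrix n n ℂ) - (b : Matrix n n ℂ)) := by
      rw [Units.val_mul, mul_sub, Units.inv_mul]
    rw [h]
    have h1 : ‖((b⁻¹ : (Matrix n n ℂ)ˣ) : Matrix n n ℂ) * ((a : Matrix n n ℂ) - (b : Matrix n n ℂ))‖ ≤ ‖(a : Matrix n n ℂ) - (b : Matrix n n ℂ)‖ :=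
      (norm_mul_le _ _).trans ((mul_le_mul_of_nonneg_right (mem_U1_of_unitary hb).2 (norm_nonneg _)).trans (one_mul _).le)
    gcongr
  have hA := hAd (hol_mem_of hWu' ((L : ℤ) • ((((L ^ k : ℕ) : ℤ)) • z)) (klastWord κ ((L : ℤ) • v₁ + boxVec L r) (L * i₁ + i' + 1)))
    ((unitaryUnits _).mul_mem (hol_mem_of hcu' ((((L ^ k : ℕ) : ℤ)) • z) (klastWord κ v₁ i₁))
      (hol_mem_of hWu' ((L : ℤ) • (((((L ^ k : ℕ) : ℤ)) • z) + v₁ + (i₁ : ℤ) • e κ)) (treeWord (boxVec L r) ++ seg κ ((i' + 1 : ℕ) : ℤ))))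
    (η ((L : ℤ) • ((((L ^ k : ℕ) : ℤ)) • z + v₁ + (i₁ : ℤ) • e κ) + boxVec L r + (i' : ℤ) • e κ) κ)
  rw [norm_sub_rev] at hstep
  have hM' : ((L ^ k : ℕ) : ℝ) = (L : ℝ) ^ k := by push_cast; ring
  calc _ ≤ (((L : ℝ) ^ d)⁻¹) ^ (k + 1) * (2 * ((4 * d + 5) * (L ^ k : ℕ) * loopRad d L x)
            * ‖η ((L : ℤ) • ((((L ^ k : ℕ) : ℤ)) • z + v₁ + (i₁ : ℤ) • e κ) + boxVec L r + (i' : ℤ) • e κ) κ‖) := by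
        refine mul_le_mul_of_nonneg_left (hA.trans ?_) hρ
        exact mul_le_mul_of_nonneg_right (mul_le_mul_of_nonneg_left hstep zero_le_two) (norm_nonneg _)
    _ = _ := by rw [hM']; ring

end Small

/-- **`TWc` AT SCALE ZERO IS THE OWN-BOND READING**: `ρ^0•TWc L 0 W η z κ − Ad (W z κ) (η z κ) = 0`. [folklore] -/
theorem TWc_zero_sub_eq (L : ℕ) (W : Site d → Fin d → (Matrix n n ℂ)ˣ) (η : Site d → Fin d → Matrix n n ℂ) (z : Site d) (κ : Fin d) :
    (((L : ℝ) ^ d)⁻¹) ^ 0 • TWc L 0 W η z κ - Ad (cavgIter L 0 W z κ) (QstrIter L 0 W η z κ) = 0 := by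
  have hb : ∀ r : Fin d → Fin 1, boxVec 1 r = 0 := fun r => funext fun ι => by simp [boxVec]
  have h0 : combTransport W 1 z κ 0 0 = 1 := by
    simp [combTransport, klastWord]
  have h1 : combTransport W 1 z κ 0 (0 + 1) = W z κ := by
    rw [combTransport_succ, h0, one_mul]; simp
  rw [pow_zero, one_smul, TWc_eq, sub_eq_zero]
  simp only [pow_zero, Finset.sum_range_one, ← sum_univ_boxVec, Fintype.sum_unique, hb, h1]
  simp only [Nat.cast_one, one_smul, add_zero, Nat.cast_zero, zero_smul]
  rfl

/-- **K4-0 — THE SINGLE-SCALE COMB LINE SUM VERSUS THE NESTED STRAIGHT TOWER** (corrected, conjugated form of the owner's row K4-0;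
`M = L^{k+1}`, small-field tower class): `‖(M^d)⁻¹•TWc L (k+1) W η z κ − Ad (cavgIter L (k+1) W z κ) (QstrIter L (k+1) W η z κ)‖`
`≤ 2·((4d+5)∕10)·DSum d L (k+1) x·(M^d)⁻¹Σ_{v∈[0,M)^d}Σ_{i<M}‖η(M•z+v+i•e_κ) κ‖` — by induction over the tower (finest level first),
the numeric recursion being `((4d+5)∕10)·DSum`. [folklore] -/
theorem norm_TWc_sub_Ad_QstrIter_le [Nonempty n] {L : ℕ} (hL2 : 2 ≤ L) :
    ∀ (k : ℕ) {W : Site d → Fin d → (Matrix n n ℂ)ˣ} {x : ℝ}, IsUnitaryCfg W → 0 ≤ x → LevelSmall d L k x → SmallField W x →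
    ∀ (η : Site d → Fin d → Matrix n n ℂ) (z : Site d) (κ : Fin d),
    ‖(((L : ℝ) ^ d)⁻¹) ^ (k + 1) • TWc L (k + 1) W η z κ - Ad (cavgIter L (k + 1) W z κ) (QstrIter L (k + 1) W η z κ)‖
      ≤ 2 * ((4 * d + 5) / 10 * DSum d L (k + 1) x) * ((((L : ℝ) ^ d)⁻¹) ^ (k + 1)
          * ∑ v ∈ periodBox (d := d) (L ^ (k + 1)), ∑ i ∈ range (L ^ (k + 1)), ‖η ((((L ^ (k + 1) : ℕ) : ℤ)) • z + v + (i : ℤ) • e κ) κ‖) := by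
  have hL : 1 ≤ L := le_trans (by norm_num) hL2
  intro k
  induction k with
  | zero =>
      intro W x hWu hx hs hWx η z κ
      obtain ⟨h512, -, -, -⟩ := step_small hL hWu hx hs.two hWx
      have h := norm_step_sub_le hL2 hWu hx h512 hWx 0 η z κ
      rw [TWc_zero_sub_eq, sub_zero] at h
      refine h.trans (le_of_eq ?_)
      rw [DSum_succ]
      simp only [DSum, pow_zero, one_mul, add_zero]
      ring
  | succ k ih =>
      intro W x hWu hx hs hWx η z κ
      obtain ⟨h512, hW₁u, hr0, hW₁x⟩ := step_small hL hWu hx hs.1 hWx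
      have hstep := norm_step_sub_le hL2 hWu hx h512 hWx (k + 1) η z κ
      have hIH := ih hW₁u hr0 hs.2 hW₁x (Qstr L W η) z κ
      have hQ := sum_norm_Qstr_le hWu hx h512 hWx hL (k + 1) η z κ
      have hre := sum_norm_reindex (n := n) hL (k + 1) η z κ
      have hρ : 0 ≤ (((L : ℝ) ^ d)⁻¹) ^ (k + 1) := by positivity
      have hmean : (((L : ℝ) ^ d)⁻¹) ^ (k + 1) * ∑ v₁ ∈ periodBox (d := d) (L ^ (k + 1)), ∑ i₁ ∈ range (L ^ (k + 1)),
            ‖Qstr L W η ((((L ^ (k + 1) : ℕ) : ℤ)) • z + v₁ + (i₁ : ℤ) • e κ) κ‖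
          ≤ (((L : ℝ) ^ d)⁻¹) ^ (k + 1 + 1) * ∑ v ∈ periodBox (d := d) (L ^ (k + 1 + 1)), ∑ i ∈ range (L ^ (k + 1 + 1)),
            ‖η ((((L ^ (k + 1 + 1) : ℕ) : ℤ)) • z + v + (i : ℤ) • e κ) κ‖ := by
        rw [hre, pow_succ _ (k + 1), mul_assoc]
        exact mul_le_mul_of_nonneg_left hQ hρ
      have hc : 0 ≤ 2 * ((4 * (d : ℝ) + 5) / 10 * DSum d L (k + 1) (prop1Radius d L x)) := by
        have := DSum_nonneg d L (k + 1) hr0; positivity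
      have hD : DSum d L (k + 1 + 1) x = (L : ℝ) ^ (k + 1) * (10 * loopRad d L x) + DSum d L (k + 1) (prop1Radius d L x) :=
        DSum_succ d L (k + 1) x
      calc _ ≤ _ + _ := norm_le_insert' _ _
        _ ≤ 2 * ((4 * (d : ℝ) + 5) / 10 * DSum d L (k + 1) (prop1Radius d L x))
              * ((((L : ℝ) ^ d)⁻¹) ^ (k + 1 + 1) * ∑ v ∈ periodBox (d := d) (L ^ (k + 1 + 1)), ∑ i ∈ range (L ^ (k + 1 + 1)),
                  ‖η ((((L ^ (k + 1 + 1) : ℕ) : ℤ)) • z + v + (i : ℤ) • e κ) κ‖)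
            + 2 * ((4 * d + 5) * (L : ℝ) ^ (k + 1) * loopRad d L x)
              * ((((L : ℝ) ^ d)⁻¹) ^ (k + 1 + 1) * ∑ v ∈ periodBox (d := d) (L ^ (k + 1 + 1)), ∑ i ∈ range (L ^ (k + 1 + 1)),
                  ‖η ((((L ^ (k + 1 + 1) : ℕ) : ℤ)) • z + v + (i : ℤ) • e κ) κ‖) :=
            add_le_add (hIH.trans (mul_le_mul_of_nonneg_left hmean hc)) hstep
        _ = _ := by rw [hD]; ring

/-- **K4-0, k-FREE FORM**: `… ≤ (16d+20)·loopRad(d, L, (prop1Radius d L)^[k] x)·(M^d)⁻¹Σ_{v,i}‖η(M•z+v+i•e_κ) κ‖` — the series is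
geometric from the top (this lineage's `DSum_le_top`), so the constant does not grow with the number of levels. [folklore] -/
theorem norm_TWc_sub_Ad_QstrIter_le_top [Nonempty n] {L : ℕ} (hL2 : 2 ≤ L) (k : ℕ) {W : Site d → Fin d → (Matrix n n ℂ)ˣ} {x : ℝ}
    (hWu : IsUnitaryCfg W) (hx : 0 ≤ x) (hs : LevelSmall d L k x) (hWx : SmallField W x)
    (η : Site d → Fin d → Matrix n n ℂ) (z : Site d) (κ : Fin d) :
    ‖(((L : ℝ) ^ d)⁻¹) ^ (k + 1) • TWc L (k + 1) W η z κ - Ad (cavgIter L (k + 1) W z κ) (QstrIter L (k + 1) W η z κ)‖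
      ≤ (16 * d + 20) * loopRad d L ((prop1Radius d L)^[k] x) * ((((L : ℝ) ^ d)⁻¹) ^ (k + 1)
          * ∑ v ∈ periodBox (d := d) (L ^ (k + 1)), ∑ i ∈ range (L ^ (k + 1)), ‖η ((((L ^ (k + 1) : ℕ) : ℤ)) • z + v + (i : ℤ) • e κ) κ‖) := by
  refine (norm_TWc_sub_Ad_QstrIter_le hL2 k hWu hx hs hWx η z κ).trans (mul_le_mul_of_nonneg_right ?_ (by positivity))
  have hD := DSum_le_top (d := d) hL2 k hx
  have hℓ : 0 ≤ (L : ℝ) ^ k * (10 * loopRad d L x) := by unfold loopRad; positivity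
  have hd : (0 : ℝ) ≤ 4 * d + 5 := by positivity
  nlinarith [mul_le_mul_of_nonneg_left hD hd]

/-- Cauchy–Schwarz for the block-line mean: `(ρ·Σ_{v,i} a)² ≤ ρ·M·Σ_{v,i} a²` (`ρ = M^{−d}`, `M^d·M` terms). [folklore] -/
theorem blockLine_mean_sq_le {M : ℕ} (hM : 1 ≤ M) (a : Site d → ℕ → ℝ) :
    ((((M : ℝ) ^ d)⁻¹) * ∑ v ∈ periodBox (d := d) M, ∑ i ∈ range M, a v i) ^ 2
      ≤ (((M : ℝ) ^ d)⁻¹) * M * ∑ v ∈ periodBox (d := d) M, ∑ i ∈ range M, a v i ^ 2 := by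
  have hM0 : (0 : ℝ) < (M : ℝ) ^ d := by positivity
  have hcard : ((periodBox (d := d) M).card : ℝ) = (M : ℝ) ^ d := by
    rw [T4AveragingDeficitWallBoundary.card_periodBox]; push_cast; ring
  have h1 := sq_sum_le_card_mul_sum_sq (s := periodBox (d := d) M) (f := fun v => ∑ i ∈ range M, a v i)
  have h2 : ∀ v ∈ periodBox (d := d) M, (∑ i ∈ range M, a v i) ^ 2 ≤ M * ∑ i ∈ range M, a v i ^ 2 := fun v _ => by
    have h := sq_sum_le_card_mul_sum_sq (s := range M) (f := fun i => a v i)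
    rwa [Finset.card_range] at h
  rw [hcard] at h1
  rw [mul_pow]
  calc (((M : ℝ) ^ d)⁻¹) ^ 2 * (∑ v ∈ periodBox (d := d) M, ∑ i ∈ range M, a v i) ^ 2
      ≤ (((M : ℝ) ^ d)⁻¹) ^ 2 * ((M : ℝ) ^ d * ∑ v ∈ periodBox (d := d) M, (∑ i ∈ range M, a v i) ^ 2) :=
        mul_le_mul_of_nonneg_left h1 (by positivity)
    _ ≤ (((M : ℝ) ^ d)⁻¹) ^ 2 * ((M : ℝ) ^ d * ∑ v ∈ periodBox (d := d) M, (M * ∑ i ∈ range M, a v i ^ 2)) := by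
        gcongr with v hv
        exact h2 v hv
    _ = (((M : ℝ) ^ d)⁻¹) * M * ∑ v ∈ periodBox (d := d) M, ∑ i ∈ range M, a v i ^ 2 := by
        rw [← Finset.mul_sum]; field_simp

/-- **K4-0, THE ℓ²(TORUS) TWIN** (`(L^{k+1}·N)`-periodic `η`, `N ≥ 1`; `M = L^{k+1}`):
`Σ_{z∈[0,N)^d} Σ_κ ‖(M^d)⁻¹•TWc − Ad (cavgIter) (QstrIter)‖² ≤ (2·((4d+5)∕10)·DSum d L (k+1) x)²·M²·(M^d)⁻¹·Σ_{y∈[0,MN)^d} Σ_κ ‖η y κ‖²`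
(both objects are lines of `M` block means, whence the `M²`; Jensen over the `M^d·M` copies, block tiling, periodicity along `κ`). [folklore] -/
theorem sum_norm_TWc_sub_Ad_QstrIter_sq_le [Nonempty n] {L : ℕ} (hL2 : 2 ≤ L) {N : ℕ} (hN : 1 ≤ N) (k : ℕ)
    {W : Site d → Fin d → (Matrix n n ℂ)ˣ} {x : ℝ} (hWu : IsUnitaryCfg W) (hx : 0 ≤ x) (hs : LevelSmall d L k x) (hWx : SmallField W x)
    (η : Site d → Fin d → Matrix n n ℂ) (hη : ∀ (y : Site d) (τ μ : Fin d), η (y + ((L ^ (k + 1) * N : ℕ) : ℤ) • e τ) μ = η y μ) :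
    ∑ z ∈ periodBox (d := d) N, ∑ κ : Fin d,
        ‖(((L : ℝ) ^ d)⁻¹) ^ (k + 1) • TWc L (k + 1) W η z κ - Ad (cavgIter L (k + 1) W z κ) (QstrIter L (k + 1) W η z κ)‖ ^ 2
      ≤ (2 * ((4 * d + 5) / 10 * DSum d L (k + 1) x)) ^ 2 * (((L : ℝ) ^ (k + 1)) ^ 2 * (((L : ℝ) ^ d)⁻¹) ^ (k + 1))
          * ∑ y ∈ periodBox (d := d) (L ^ (k + 1) * N), ∑ κ : Fin d, ‖η y κ‖ ^ 2 := by
  have hL : 1 ≤ L := le_trans (by norm_num) hL2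
  set M : ℕ := L ^ (k + 1) with hMdef
  set C : ℝ := 2 * ((4 * d + 5) / 10 * DSum d L (k + 1) x) with hC
  have hM1 : 1 ≤ M := Nat.one_le_pow _ _ hL
  have hC0 : 0 ≤ C := by have := DSum_nonneg d L (k + 1) hx; positivity
  have hρM : (((L : ℝ) ^ d)⁻¹) ^ (k + 1) = ((M : ℝ) ^ d)⁻¹ := by
    rw [hMdef]; push_cast; rw [← inv_pow, ← pow_mul, ← pow_mul, mul_comm, inv_pow]
  -- pointwise: square of the END bound, then Jensen over the copies
  have hpt : ∀ (z : Site d) (κ : Fin d),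
      ‖(((L : ℝ) ^ d)⁻¹) ^ (k + 1) • TWc L (k + 1) W η z κ - Ad (cavgIter L (k + 1) W z κ) (QstrIter L (k + 1) W η z κ)‖ ^ 2
        ≤ C ^ 2 * ((((M : ℝ) ^ d)⁻¹) * M * ∑ v ∈ periodBox (d := d) M, ∑ i ∈ range M, ‖η (((M : ℕ) : ℤ) • z + v + (i : ℤ) • e κ) κ‖ ^ 2) := by
    intro z κ
    have h := norm_TWc_sub_Ad_QstrIter_le hL2 k hWu hx hs hWx η z κ
    rw [hρM] at h ⊢
    calc _ ≤ (C * ((((M : ℝ) ^ d)⁻¹) * ∑ v ∈ periodBox (d := d) M, ∑ i ∈ range M, ‖η (((M : ℕ) : ℤ) • z + v + (i : ℤ) • e κ) κ‖)) ^ 2 :=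
          pow_le_pow_left₀ (norm_nonneg _) h 2
      _ ≤ _ := by rw [mul_pow]; exact mul_le_mul_of_nonneg_left (blockLine_mean_sq_le hM1 _) (by positivity)
  -- sum over the torus: block tiling and periodicity along κ
  have hsum : ∀ κ : Fin d, ∑ z ∈ periodBox (d := d) N, ∑ v ∈ periodBox (d := d) M, ∑ i ∈ range M, ‖η (((M : ℕ) : ℤ) • z + v + (i : ℤ) • e κ) κ‖ ^ 2
      = M * ∑ y ∈ periodBox (d := d) (M * N), ‖η y κ‖ ^ 2 := by
    intro κ
    have h1 : ∑ z ∈ periodBox (d := d) N, ∑ v ∈ periodBox (d := d) M, ∑ i ∈ range M, ‖η (((M : ℕ) : ℤ) • z + v + (i : ℤ) • e κ) κ‖ ^ 2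
        = ∑ y ∈ periodBox (d := d) (M * N), ∑ i ∈ range M, ‖η (y + (i : ℤ) • e κ) κ‖ ^ 2 :=
      sum_periodBox_blocks M N hM1 (fun y => ∑ i ∈ range M, ‖η (y + (i : ℤ) • e κ) κ‖ ^ 2)
    rw [h1, Finset.sum_comm]
    have h2 : ∀ i ∈ range M, ∑ y ∈ periodBox (d := d) (M * N), ‖η (y + (i : ℤ) • e κ) κ‖ ^ 2 = ∑ y ∈ periodBox (d := d) (M * N), ‖η y κ‖ ^ 2 :=
      fun i _ => sum_periodBox_shift (M * N) (Nat.mul_pos (by omega) (by omega))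
        (g := fun y => ‖η y κ‖ ^ 2) (fun y τ => by simp only [hMdef]; rw [hη]) _
    rw [Finset.sum_congr rfl h2, Finset.sum_const, Finset.card_range, nsmul_eq_mul]
  calc _ ≤ ∑ z ∈ periodBox (d := d) N, ∑ κ : Fin d,
          C ^ 2 * ((((M : ℝ) ^ d)⁻¹) * M * ∑ v ∈ periodBox (d := d) M, ∑ i ∈ range M, ‖η (((M : ℕ) : ℤ) • z + v + (i : ℤ) • e κ) κ‖ ^ 2) :=
        Finset.sum_le_sum fun z _ => Finset.sum_le_sum fun κ _ => hpt z κ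
    _ = C ^ 2 * (((M : ℝ) ^ 2) * ((M : ℝ) ^ d)⁻¹) * ∑ y ∈ periodBox (d := d) (M * N), ∑ κ : Fin d, ‖η y κ‖ ^ 2 := by
        rw [Finset.sum_comm]
        simp only [← Finset.mul_sum]
        rw [Finset.sum_comm (s := periodBox (d := d) (M * N))]
        simp only [hsum, Finset.mul_sum]
        refine Finset.sum_congr rfl fun κ _ => Finset.sum_congr rfl fun y _ => by ring
    _ = _ := by rw [hρM, hMdef]; push_cast; ring

end

end Summit.QuantumFields.BalabanUV.T4Continuum.NE3CombVsTowerEnd
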